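/-
Copyright (c) 2026 the pub-hodgecm-mathlib formalisation cell (harness21).  Prover seat hodgecm-mathlib-LH7-p05 (g3), Track B «K2-LIT» ∕ hLiu418 #184♮ =
`stmt-HodgeConjecture-24832`, socket #41 KIND 1 a♮, the (dec) count road in the `D`-currency (K1a desk K2E5-p16 (g8) WORD #12): sub-brick (C-d-i) of K2Liu-p03 (g8)'s
(C-d) `K2LiuKindOneSingularShellCount.pow_card_Pm_le_den` (his SIG 2026-09-05T01:43:23Z, bytes frozen) — «THE CORNER SCALAR HAS A UNIFORM DENOMINATOR AND ITS POLE
PLACES ARE COUNTED BY IT».  THEOREMS ONLY (no `def`, no `instance`, no notation, no named-fact hypothesis, no `sorry`); lane `--supports stmt-HodgeConjecture-24832 --as helper`.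
-/
import Summits.HodgeConjecture.HodgeConjecture.Theorems.K2LiuRankOneIndexValueTwoCorner      -- ★ `gramR_apply_same_ne_zero` (diagonal Gram entries of the rank-2 frame are non-zero)
import Summits.HodgeConjecture.HodgeConjecture.Theorems.K2LiuSiegelEisensteinKindWOfRecord    -- ★ `exists_nat_den` (clearing denominators over `ℤ`)
import Summits.HodgeConjecture.HodgeConjecture.Theorems.K2LiuKindWPlacesCount                 -- ★ p864221 `valuation_natCast_lt_one_of_one_lt` (`D·y` integral, `|y| > 1 ⇒ |D| < 1`)
import Summits.HodgeConjecture.HodgeConjecture.Theorems.K2LiuIdealPrimeCountLetter            -- ★ p864063 `rpow_card_le_natCast_rpow_of_valuation_lt_one` (`c^{#T} ≤ D^{[K:ℚ]·log₂ c}`)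
import Mathlib.RingTheory.Trace.Basic
import Literature.NumberTheory.GelbartRogawski1991.Prop311PrintedSymplecticFrame         -- ★ `Prop311.algebraMap_trace_eq_add` (`Tr_{L∕L⁺} y = y + ȳ`; ED. 2)
import Mathlib.NumberTheory.NumberField.InfinitePlace.Ramification                    -- Mathlib `InfinitePlace.comap_surjective` (ED. 2)
import HarnessLib

/-!
# Crux `HLiu418`, socket #41, KIND 1 a♮ (dec) — `K2LiuCornerScalarPoleCount`: A UNIFORM DENOMINATOR FOR THE CORNER SCALAR, AND THE COUNT OF ITS POLE PLACES
# `∃ d₀ ≠ 0, ∀ σ x k D, D·x integral ∧ g_kk·x = g_11·σ ⇒ (D d₀)·σ integral ∧ (16∕3)^{#{v : |g₁₁·Tr(σδ)|_v > 1}} ≤ (D d₀)^{3[L⁺:ℚ]}`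

Cell `hodgecm-mathlib`, crux item hLiu418 = `stmt-HodgeConjecture-24832` (helper lane, count-neutral; closes no socket).  Namespace
`Summit.HodgeConjecture.HodgeConjecture.Cruxes.HLiu418.K2LiuCornerScalarPoleCount`.

WHY.  In (C-d) `pow_card_Pm_le_den` (K2Liu-p03 (g8)), the moving bad-place set of the singular tail of record splits as `#Pm S h ≤ #Trec + #Pol(τ(σc S)) +
#(kindWFinset (T₀ ∪ Tp S) (σc(S)E₁₁) (gc S·h) ∖ (T₀ ∪ Tp S))`; the third term is ★ p864221 (C-c), and THIS FILE is the second: the corner scalar `σ = σc S` is tied to an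
entry `x = S_kk` of the index by the pivot letter `g_kk · x = g_11 · σ` (★ (C-b)'s (g)), so a denominator `D` of `x` becomes the denominator `D·d₀` of `σ` and of
`τ(σ) = g₁₁ · Tr_{L∕L⁺}(σ·δ)` for ONE natural `d₀` depending only on the frame (`d₀ = d_r · d_δ · d_g` clears `g_kk∕g_11`, `δ = imagUnit L`, `g₁₁`); the places `v` of `L⁺`
with `|τ(σ)|_v > 1` then divide `D·d₀` (★ `valuation_natCast_lt_one_of_one_lt`), and ★ p864063 counts them: `(16∕3)^{#P} ≤ (D d₀)^{[L⁺:ℚ]·log₂(16∕3)} ≤ (D d₀)^{3[L⁺:ℚ]}`.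
* §1 tools: **`isIntegral_natCast_mul`** (`n · y` integral when `y` is); **`trace_natCast_mul`** (`Tr((n:L)·y) = n·Tr(y)`); **`logb_two_sixteen_thirds_le_three`**.
* §2 **`exists_cornerScalar_den_pole_count`** — the head, on K2Liu-p03's SIG bytes (01:43:23Z).
* §3 (ED. 2, append-only; K2Liu-p03 (g8)'s (L5-i) SIG 01:55:13Z, consumed by his (L5-den) `K2LiuKindOneSingularShellSize.norm_prod_shell_le_den`)
  **`exists_cornerScalar_tau_letters`** — `∃ d₀ Cτ`: (i) `(D·d₀)·τ(σ)` is `ℤ`-integral IN `L⁺` (the step internal to §2, exported); (ii) `|τ(σ)|_w ≤ Cτ·B` at every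
  infinite place `w` of `L⁺` whenever `|x|_{w′} ≤ B` at all infinite places `w′` of `L` (`Tr = 1 + c̄` ★ `Prop311.algebraMap_trace_eq_add`, `|ȳ| = |y|` Mathlib
  `infinitePlace_complexConj`, `w = w′ ∘ ι` Mathlib `InfinitePlace.comap_surjective`); tool `infinitePlace_algebraMap_trace_le` (`|Tr y|_{w′} ≤ 2|y|_{w′}`).
References: [NeukirchANT1999, Ch. I §2 (integral elements, trace of an integral element is integral), Ch. I §3 Thm. (3.3), Ch. I §6 Prop. (6.1)];
[Shimura1997, §18.1 (the corner index of a rank-one Hermitian matrix)]; [KudlaRallis1994, §2 (2.10)–(2.12)].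
HONEST LABEL: HC_CM is proved only modulo the 7 printed citations (2 remaining named inputs: hLiu418 = stmt-HodgeConjecture-24832, h413 = stmt-HodgeConjecture-24833) until
rung 0 closes; count-neutral helper (`--supports stmt-HodgeConjecture-24832 --as helper`), closes no socket, moves no counter.
-/

set_option autoImplicit false
set_option linter.dupNamespace false -- the mandated namespace repeats `HodgeConjecture.HodgeConjecture`

noncomputable section

open scoped Matrix
open NumberField IsDedekindDomain
open Literature.NumberTheory.Automorphic
open Literature.NumberTheory.GelbartRogawski1991 Literature.NumberTheory.GelbartRogawski1991.GRConstruction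
open Literature.NumberTheory.GelbartRogawski1991.UnitaryDualPair
open Summit.HodgeConjecture.HodgeConjecture.Cruxes.HLiu418.K2LiuRankOneIndexValueTwoCorner (gramR_apply_same_ne_zero)
open Summit.HodgeConjecture.HodgeConjecture.Cruxes.HLiu418.K2LiuSiegelEisensteinKindWOfRecord (exists_nat_den)
open Summit.HodgeConjecture.HodgeConjecture.Cruxes.HLiu418.K2LiuKindWPlacesCount (valuation_natCast_lt_one_of_one_lt)
open Summit.HodgeConjecture.HodgeConjecture.Cruxes.HLiu418.K2LiuIdealPrimeCountLetter (rpow_card_le_natCast_rpow_of_valuation_lt_one)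

namespace Summit.HodgeConjecture.HodgeConjecture.Cruxes.HLiu418.K2LiuCornerScalarPoleCount

/-! ## §1 Tools -/

section Tools

/-- A natural multiple of a `ℤ`-integral element is `ℤ`-integral. [cite: NeukirchANT1999, Ch. I §2] -/
theorem isIntegral_natCast_mul {A : Type*} [CommRing A] [Algebra ℤ A] (n : ℕ) {y : A} (hy : IsIntegral ℤ y) : IsIntegral ℤ ((n : A) * y) := by
  have hn : IsIntegral ℤ ((n : A)) := by
    rw [show ((n : A)) = algebraMap ℤ A n by simp]
    exact isIntegral_algebraMap
  exact hn.mul hy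

/-- The trace is linear over natural scalars: `Tr_{F∕K}((n : F) · y) = n · Tr_{F∕K}(y)`. [folklore] -/
theorem trace_natCast_mul {K F : Type*} [Field K] [Field F] [Algebra K F] (n : ℕ) (y : F) :
    Algebra.trace K F ((n : F) * y) = (n : K) * Algebra.trace K F y := by
  rw [show ((n : F)) * y = (n : K) • y by rw [Algebra.smul_def, map_natCast], LinearMap.map_smul, smul_eq_mul]

/-- `log₂ (16∕3) ≤ 3` (as `16∕3 ≤ 8 = 2³`). [folklore] -/
theorem logb_two_sixteen_thirds_le_three : Real.logb 2 (16 / 3 : ℝ) ≤ 3 := by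
  rw [Real.logb_le_iff_le_rpow one_lt_two (by norm_num)]
  rw [show (3 : ℝ) = ((3 : ℕ) : ℝ) by norm_num, Real.rpow_natCast]
  norm_num

end Tools

/-! ## §2 The head -/

section Head

variable (L : Type) [Field L] [NumberField L] [IsCMField L]
variable {N M : ℕ} (e : Fin N × Fin M ≃ Fin 2)
  (dV : Fin N → L) (hdV : ∀ i, IsCMField.complexConj L (dV i) = dV i)
  (dW : Fin M → L) (hdW : ∀ i, IsCMField.complexConj L (dW i) = dW i)

/-- **A UNIFORM DENOMINATOR FOR THE CORNER SCALAR, AND THE COUNT OF ITS POLE PLACES** (K2Liu-p03 (g8)'s (C-d-i) SIG, 2026-09-05T01:43:23Z).  For the rank-2 CM frame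
`(e, dV, dW)` (non-degenerate: `hdV0 hdW0`) there is ONE natural `d₀ ≠ 0` such that for every corner scalar `σ`, entry `x`, pivot `k` and denominator `D ≠ 0` with `D·x`
`ℤ`-integral and the pivot letter `G_kk · x = G_11 · σ` (`G = gramR` read in `L`): (i) `(D·d₀)·σ` is `ℤ`-integral; (ii) for every finset `P` of finite places of `L⁺` at which
`|g₁₁ · Tr_{L∕L⁺}(σ·δ)|_v > 1` (`δ = imagUnit L`), `(16∕3)^{#P} ≤ (D·d₀)^{3·[L⁺:ℚ]}`.  Proof: `d₀ = d_r·d_δ·d_g` with `d_r·(g_kk∕g_11)` (both `k`), `d_δ·δ`, `d_g·g₁₁`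
`ℤ`-integral (★ `exists_nat_den`; `g_kk ≠ 0` ★ `gramR_apply_same_ne_zero`); `σ = (g_kk∕g_11)·x`; `(D d₀)·τ = (d_g g₁₁)·Tr((D d_r σ)(d_δ δ))` is `ℤ`-integral (Mathlib
`Algebra.isIntegral_trace`); on `P`, `|D d₀|_v < 1` (★ `valuation_natCast_lt_one_of_one_lt`), so ★ p864063 `rpow_card_le_natCast_rpow_of_valuation_lt_one (c := 16∕3)`
and `log₂(16∕3) ≤ 3`. [cite: NeukirchANT1999, Ch. I §2; Ch. I §3 Thm. (3.3); Ch. I §6 Prop. (6.1)] [cite: Shimura1997, §18.1] -/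
theorem exists_cornerScalar_den_pole_count (hdV0 : ∀ i, dV i ≠ 0) (hdW0 : ∀ i, dW i ≠ 0) :
    ∃ d₀ : ℕ, d₀ ≠ 0 ∧ ∀ (σ x : L) (k : Fin 2) (D : ℕ), D ≠ 0 → IsIntegral ℤ ((D : L) * x) →
      ((gramR L e dV hdV dW hdW).map (algebraMap (Fp L) L)) k k * x = ((gramR L e dV hdV dW hdW).map (algebraMap (Fp L) L)) 1 1 * σ →
      IsIntegral ℤ (((D * d₀ : ℕ) : L) * σ) ∧
        ∀ P : Finset (HeightOneSpectrum (𝓞 (Fp L))),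
          (∀ v ∈ P, 1 < Valued.v (algebraMap (Fp L) (v.adicCompletion (Fp L)) (gramR L e dV hdV dW hdW 1 1 * Algebra.trace (Fp L) L (σ * imagUnit L)))) →
          (16 / 3 : ℝ) ^ P.card ≤ ((D * d₀ : ℕ) : ℝ) ^ (3 * Module.finrank ℚ (Fp L)) := by
  classical
  -- the frame's three denominators: `d_r` for the ratios `g_kk ∕ g_11` (read in `L`), `d_δ` for `δ`, `d_g` for `g₁₁` (in `L⁺`)
  set g : Matrix (Fin 2) (Fin 2) (Fp L) := gramR L e dV hdV dW hdW with hg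
  have hg11 : g 1 1 ≠ 0 := gramR_apply_same_ne_zero L e dV hdV hdV0 dW hdW hdW0 1
  obtain ⟨dr, hdr1, hdr⟩ := exists_nat_den L (Matrix.diagonal fun k : Fin 2 => algebraMap (Fp L) L (g k k / g 1 1))
  obtain ⟨dδ, hdδ1, hdδ⟩ := exists_nat_den L (Matrix.diagonal fun _ : Fin 1 => imagUnit L)
  obtain ⟨dg, hdg1, hdg⟩ := exists_nat_den (Fp L) (Matrix.diagonal fun _ : Fin 1 => g 1 1)
  have hr : ∀ k : Fin 2, IsIntegral ℤ ((dr : L) * algebraMap (Fp L) L (g k k / g 1 1)) := fun k => by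
    simpa only [Matrix.diagonal_apply_eq] using hdr k k
  have hδ : IsIntegral ℤ ((dδ : L) * imagUnit L) := by simpa only [Matrix.diagonal_apply_eq] using hdδ 0 0
  have hg1 : IsIntegral ℤ ((dg : Fp L) * g 1 1) := by simpa only [Matrix.diagonal_apply_eq] using hdg 0 0
  refine ⟨dr * dδ * dg, by positivity, fun σ x k D hD hx hpiv => ?_⟩
  -- `σ = (g_kk ∕ g_11) · x`
  have hG11 : algebraMap (Fp L) L (g 1 1) ≠ 0 := fun h => hg11 ((map_eq_zero _).1 h)
  have hσ : σ = algebraMap (Fp L) L (g k k / g 1 1) * x := by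
    have h1 : algebraMap (Fp L) L (g k k) * x = algebraMap (Fp L) L (g 1 1) * σ := by
      simpa only [Matrix.map_apply, hg] using hpiv
    rw [map_div₀, div_mul_eq_mul_div, h1, eq_div_iff hG11, mul_comm]
  -- (i) `(D·d_r)·σ = (d_r·g_kk∕g_11)·(D·x)` is integral, hence so is `(D·d₀)·σ`
  have hDr : IsIntegral ℤ (((D * dr : ℕ) : L) * σ) := by
    have h := (hr k).mul hx
    have heq : ((D * dr : ℕ) : L) * σ = (dr : L) * algebraMap (Fp L) L (g k k / g 1 1) * ((D : L) * x) := by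
      rw [hσ]; push_cast; ring
    rw [heq]
    exact h
  have hint : IsIntegral ℤ (((D * (dr * dδ * dg) : ℕ) : L) * σ) := by
    have heq : ((D * (dr * dδ * dg) : ℕ) : L) * σ = ((dδ * dg : ℕ) : L) * (((D * dr : ℕ) : L) * σ) := by push_cast; ring
    rw [heq]
    exact isIntegral_natCast_mul _ hDr
  refine ⟨hint, fun P hP => ?_⟩
  -- (ii) the pole places of `τ(σ) = g₁₁ · Tr(σ·δ)` divide `D·d₀`
  set τ : Fp L := g 1 1 * Algebra.trace (Fp L) L (σ * imagUnit L) with hτ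
  -- `(D d₀)·τ = (d_g g₁₁) · Tr((D d_r σ)·(d_δ δ))` is `ℤ`-integral in `L⁺`
  have hτint : IsIntegral ℤ (((D * (dr * dδ * dg) : ℕ) : Fp L) * τ) := by
    have hprod : IsIntegral ℤ ((((D * dr : ℕ) : L) * σ) * ((dδ : L) * imagUnit L)) := hDr.mul hδ
    have htr : IsIntegral ℤ (Algebra.trace (Fp L) L ((((D * dr : ℕ) : L) * σ) * ((dδ : L) * imagUnit L))) :=
      Algebra.isIntegral_trace hprod
    have heq : ((D * (dr * dδ * dg) : ℕ) : Fp L) * τ =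
        ((dg : Fp L) * g 1 1) * Algebra.trace (Fp L) L ((((D * dr : ℕ) : L) * σ) * ((dδ : L) * imagUnit L)) := by
      have h2 : (((D * dr : ℕ) : L) * σ) * ((dδ : L) * imagUnit L) = ((D * dr * dδ : ℕ) : L) * (σ * imagUnit L) := by push_cast; ring
      rw [h2, trace_natCast_mul, hτ]
      push_cast
      ring
    rw [heq]
    exact hg1.mul htr
  have hlt : ∀ v ∈ P, Valued.v (algebraMap (Fp L) (v.adicCompletion (Fp L)) (((D * (dr * dδ * dg) : ℕ) : Fp L))) < 1 := by
    intro v hv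
    have h1 : 1 < v.valuation (Fp L) τ := by
      have h := hP v hv
      rw [HeightOneSpectrum.algebraMap_adicCompletion, Function.comp_apply, Algebra.algebraMap_self_apply,
        HeightOneSpectrum.valuedAdicCompletion_eq_valuation'] at h
      exact h
    have h2 := valuation_natCast_lt_one_of_one_lt (Fp L) v hτint h1
    rw [HeightOneSpectrum.algebraMap_adicCompletion, Function.comp_apply, Algebra.algebraMap_self_apply,
      HeightOneSpectrum.valuedAdicCompletion_eq_valuation']
    exact h2
  have hD0 : D * (dr * dδ * dg) ≠ 0 := by positivity
  have hc : (1 : ℝ) ≤ 16 / 3 := by norm_num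
  have hcount := rpow_card_le_natCast_rpow_of_valuation_lt_one (K := Fp L) hD0 P hlt hc
  -- `(D d₀)^{[L⁺:ℚ]·log₂(16∕3)} ≤ (D d₀)^{3·[L⁺:ℚ]}`
  have hbase : (1 : ℝ) ≤ ((D * (dr * dδ * dg) : ℕ) : ℝ) := by exact_mod_cast Nat.one_le_iff_ne_zero.2 hD0
  calc (16 / 3 : ℝ) ^ P.card ≤ ((D * (dr * dδ * dg) : ℕ) : ℝ) ^ ((Module.finrank ℚ (Fp L) : ℝ) * Real.logb 2 (16 / 3 : ℝ)) := hcount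
    _ ≤ ((D * (dr * dδ * dg) : ℕ) : ℝ) ^ ((3 * Module.finrank ℚ (Fp L) : ℕ) : ℝ) := by
        refine Real.rpow_le_rpow_of_exponent_le hbase ?_
        rw [Nat.cast_mul, Nat.cast_ofNat, mul_comm (3 : ℝ)]
        exact mul_le_mul_of_nonneg_left logb_two_sixteen_thirds_le_three (Nat.cast_nonneg _)
    _ = ((D * (dr * dδ * dg) : ℕ) : ℝ) ^ (3 * Module.finrank ℚ (Fp L)) := Real.rpow_natCast _ _

end Head

/-! ## §3 (ED. 2) The `τ`-letters of the corner scalar: integrality of `(D d₀)·τ` in `L⁺` AND the archimedean size `|τ|_w ≤ Cτ · max_w′ |x|_w′` -/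

section TauLetters

variable (L : Type) [Field L] [NumberField L] [IsCMField L]

/-- **`|Tr_{L∕L⁺}(y)|_{w′} ≤ 2·|y|_{w′}`** at every infinite place `w′` of `L` (read through `algebraMap L⁺ L`): `Tr(y) = y + ȳ` (★ `Prop311.algebraMap_trace_eq_add` at
`σ := complexConj`, `δ := imagUnit L`) and `|ȳ|_{w′} = |y|_{w′}` (Mathlib `infinitePlace_complexConj`). [cite: GelbartRogawski1991, §1.1 p. 449 L26] [cite: NeukirchANT1999, Ch. I §2] -/
theorem infinitePlace_algebraMap_trace_le (w' : NumberField.InfinitePlace L) (y : L) :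
    w' (algebraMap (Fp L) L (Algebra.trace (Fp L) L y)) ≤ 2 * w' y := by
  haveI : Algebra.IsQuadraticExtension (Fp L) L := IsCMField.isQuadraticExtension L
  rw [Prop311.algebraMap_trace_eq_add (Fp L) L (IsCMField.complexConj L) (complexConj_imagUnit L) (imagUnit_ne_zero L) y,
    ← NumberField.InfinitePlace.norm_embedding_eq, map_add]
  calc ‖(NumberField.InfinitePlace.embedding w') y + (NumberField.InfinitePlace.embedding w') (IsCMField.complexConj L y)‖
      ≤ ‖(NumberField.InfinitePlace.embedding w') y‖ + ‖(NumberField.InfinitePlace.embedding w') (IsCMField.complexConj L y)‖ := norm_add_le _ _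
    _ = w' y + w' (IsCMField.complexConj L y) := by rw [NumberField.InfinitePlace.norm_embedding_eq, NumberField.InfinitePlace.norm_embedding_eq]
    _ = 2 * w' y := by rw [IsCMField.infinitePlace_complexConj]; ring

variable {N M : ℕ} (e : Fin N × Fin M ≃ Fin 2)
  (dV : Fin N → L) (hdV : ∀ i, IsCMField.complexConj L (dV i) = dV i)
  (dW : Fin M → L) (hdW : ∀ i, IsCMField.complexConj L (dW i) = dW i)

/-- **THE `τ`-LETTERS OF THE CORNER SCALAR** (K2Liu-p03 (g8)'s (L5-i) SIG, 2026-09-05T01:55:13Z).  For the rank-2 CM frame there are ONE natural `d₀ ≠ 0` and ONE real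
`Cτ ≥ 0` such that for every corner scalar `σ`, entry `x`, pivot `k` and denominator `D ≠ 0` with `D·x` `ℤ`-integral and the pivot letter `G_kk · x = G_11 · σ`:
(i) `(D·d₀) · τ(σ)` is `ℤ`-integral IN `L⁺`, `τ(σ) := g₁₁ · Tr_{L∕L⁺}(σ·δ)` (the step internal to ★ ED. 1's head, exported); (ii) for every real `B` bounding `x` at all
infinite places of `L`, `|τ(σ)|_w ≤ Cτ · B` at every infinite place `w` of `L⁺` — `w = w′ ∘ ι` for some `w′` of `L` (Mathlib `InfinitePlace.comap_surjective`),
`|Tr(σδ)|_{w′} ≤ 2|σ|_{w′}|δ|_{w′}` (`infinitePlace_algebraMap_trace_le`), `σ = (g_kk∕g_11)·x`; `Cτ := 2·Σ_{w′,k} |g₁₁|_{w′}·|g_kk∕g_11|_{w′}·|δ|_{w′}`.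
[cite: NeukirchANT1999, Ch. I §2; Ch. III §1] [cite: Shimura1997, §18.1] [cite: GelbartRogawski1991, §1.1 p. 449 L26] -/
theorem exists_cornerScalar_tau_letters (hdV0 : ∀ i, dV i ≠ 0) (hdW0 : ∀ i, dW i ≠ 0) :
    ∃ (d₀ : ℕ) (Cτ : ℝ), d₀ ≠ 0 ∧ 0 ≤ Cτ ∧ ∀ (σ x : L) (k : Fin 2) (D : ℕ), D ≠ 0 → IsIntegral ℤ ((D : L) * x) →
      ((gramR L e dV hdV dW hdW).map (algebraMap (Fp L) L)) k k * x = ((gramR L e dV hdV dW hdW).map (algebraMap (Fp L) L)) 1 1 * σ →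
      IsIntegral ℤ (((D * d₀ : ℕ) : Fp L) * (gramR L e dV hdV dW hdW 1 1 * Algebra.trace (Fp L) L (σ * imagUnit L))) ∧
        ∀ B : ℝ, (∀ w' : NumberField.InfinitePlace L, w' x ≤ B) →
          ∀ w : NumberField.InfinitePlace (Fp L), w (gramR L e dV hdV dW hdW 1 1 * Algebra.trace (Fp L) L (σ * imagUnit L)) ≤ Cτ * B := by
  classical
  -- the frame's three denominators, as in ★ ED. 1
  set g : Matrix (Fin 2) (Fin 2) (Fp L) := gramR L e dV hdV dW hdW with hg
  have hg11 : g 1 1 ≠ 0 := gramR_apply_same_ne_zero L e dV hdV hdV0 dW hdW hdW0 1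
  obtain ⟨dr, hdr1, hdr⟩ := exists_nat_den L (Matrix.diagonal fun k : Fin 2 => algebraMap (Fp L) L (g k k / g 1 1))
  obtain ⟨dδ, hdδ1, hdδ⟩ := exists_nat_den L (Matrix.diagonal fun _ : Fin 1 => imagUnit L)
  obtain ⟨dg, hdg1, hdg⟩ := exists_nat_den (Fp L) (Matrix.diagonal fun _ : Fin 1 => g 1 1)
  have hr : ∀ k : Fin 2, IsIntegral ℤ ((dr : L) * algebraMap (Fp L) L (g k k / g 1 1)) := fun k => by
    simpa only [Matrix.diagonal_apply_eq] using hdr k k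
  have hδ : IsIntegral ℤ ((dδ : L) * imagUnit L) := by simpa only [Matrix.diagonal_apply_eq] using hdδ 0 0
  have hg1 : IsIntegral ℤ ((dg : Fp L) * g 1 1) := by simpa only [Matrix.diagonal_apply_eq] using hdg 0 0
  -- the archimedean constant: `Cτ := 2 · Σ_{w′} Σ_k |g₁₁|_{w′} · |g_kk ∕ g_11|_{w′} · |δ|_{w′}`
  set Cτ : ℝ := 2 * ∑ w' : NumberField.InfinitePlace L, ∑ k : Fin 2,
      w' (algebraMap (Fp L) L (g 1 1)) * w' (algebraMap (Fp L) L (g k k / g 1 1)) * w' (imagUnit L) with hCτ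
  have hCτ0 : 0 ≤ Cτ := by
    rw [hCτ]
    refine mul_nonneg zero_le_two (Finset.sum_nonneg fun w' _ => Finset.sum_nonneg fun k _ => ?_)
    exact mul_nonneg (mul_nonneg (apply_nonneg _ _) (apply_nonneg _ _)) (apply_nonneg _ _)
  refine ⟨dr * dδ * dg, Cτ, by positivity, hCτ0, fun σ x k D hD hx hpiv => ?_⟩
  -- `σ = (g_kk ∕ g_11) · x`
  have hG11 : algebraMap (Fp L) L (g 1 1) ≠ 0 := fun h => hg11 ((map_eq_zero _).1 h)
  have hσ : σ = algebraMap (Fp L) L (g k k / g 1 1) * x := by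
    have h1 : algebraMap (Fp L) L (g k k) * x = algebraMap (Fp L) L (g 1 1) * σ := by
      simpa only [Matrix.map_apply, hg] using hpiv
    rw [map_div₀, div_mul_eq_mul_div, h1, eq_div_iff hG11, mul_comm]
  have hDr : IsIntegral ℤ (((D * dr : ℕ) : L) * σ) := by
    have h := (hr k).mul hx
    have heq : ((D * dr : ℕ) : L) * σ = (dr : L) * algebraMap (Fp L) L (g k k / g 1 1) * ((D : L) * x) := by
      rw [hσ]; push_cast; ring
    rw [heq]
    exact h
  refine ⟨?_, fun B hB w => ?_⟩
  · -- (i) `(D d₀)·τ = (d_g g₁₁) · Tr((D d_r σ)·(d_δ δ))` is `ℤ`-integral in `L⁺`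
    have hprod : IsIntegral ℤ ((((D * dr : ℕ) : L) * σ) * ((dδ : L) * imagUnit L)) := hDr.mul hδ
    have htr : IsIntegral ℤ (Algebra.trace (Fp L) L ((((D * dr : ℕ) : L) * σ) * ((dδ : L) * imagUnit L))) :=
      Algebra.isIntegral_trace hprod
    have heq : ((D * (dr * dδ * dg) : ℕ) : Fp L) * (g 1 1 * Algebra.trace (Fp L) L (σ * imagUnit L)) =
        ((dg : Fp L) * g 1 1) * Algebra.trace (Fp L) L ((((D * dr : ℕ) : L) * σ) * ((dδ : L) * imagUnit L)) := by
      have h2 : (((D * dr : ℕ) : L) * σ) * ((dδ : L) * imagUnit L) = ((D * dr * dδ : ℕ) : L) * (σ * imagUnit L) := by push_cast; ring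
      rw [h2, trace_natCast_mul]
      push_cast
      ring
    rw [heq]
    exact hg1.mul htr
  · -- (ii) the archimedean size of `τ` at `w = w′ ∘ ι`
    obtain ⟨w', hw'⟩ := NumberField.InfinitePlace.comap_surjective (k := Fp L) (K := L) w
    have hB0 : 0 ≤ B := (apply_nonneg w' x).trans (hB w')
    have hwι : ∀ t : Fp L, w t = w' (algebraMap (Fp L) L t) := fun t => by
      rw [← hw', NumberField.InfinitePlace.comap_apply]
    rw [hwι, map_mul, map_mul]
    -- `|Tr(σδ)|_{w′} ≤ 2 |σ|_{w′} |δ|_{w′} = 2 |g_kk∕g_11|_{w′} |x|_{w′} |δ|_{w′}`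
    have htr : w' (algebraMap (Fp L) L (Algebra.trace (Fp L) L (σ * imagUnit L))) ≤
        2 * (w' (algebraMap (Fp L) L (g k k / g 1 1)) * w' x * w' (imagUnit L)) := by
      have h := infinitePlace_algebraMap_trace_le L w' (σ * imagUnit L)
      have hmul : w' (σ * imagUnit L) = w' (algebraMap (Fp L) L (g k k / g 1 1)) * w' x * w' (imagUnit L) := by
        rw [map_mul, hσ, map_mul]
      rw [hmul] at h
      linarith
    -- one term of the sum defining `Cτ`
    have hterm : w' (algebraMap (Fp L) L (g 1 1)) * w' (algebraMap (Fp L) L (g k k / g 1 1)) * w' (imagUnit L) ≤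
        ∑ w'' : NumberField.InfinitePlace L, ∑ k' : Fin 2,
          w'' (algebraMap (Fp L) L (g 1 1)) * w'' (algebraMap (Fp L) L (g k' k' / g 1 1)) * w'' (imagUnit L) := by
      have h1 : w' (algebraMap (Fp L) L (g 1 1)) * w' (algebraMap (Fp L) L (g k k / g 1 1)) * w' (imagUnit L) ≤
          ∑ k' : Fin 2, w' (algebraMap (Fp L) L (g 1 1)) * w' (algebraMap (Fp L) L (g k' k' / g 1 1)) * w' (imagUnit L) :=
        Finset.single_le_sum (f := fun k' : Fin 2 => w' (algebraMap (Fp L) L (g 1 1)) * w' (algebraMap (Fp L) L (g k' k' / g 1 1)) * w' (imagUnit L))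
          (fun k' _ => mul_nonneg (mul_nonneg (apply_nonneg _ _) (apply_nonneg _ _)) (apply_nonneg _ _)) (Finset.mem_univ k)
      refine h1.trans ?_
      exact Finset.single_le_sum (f := fun w'' : NumberField.InfinitePlace L => ∑ k' : Fin 2,
          w'' (algebraMap (Fp L) L (g 1 1)) * w'' (algebraMap (Fp L) L (g k' k' / g 1 1)) * w'' (imagUnit L))
        (fun w'' _ => Finset.sum_nonneg fun k' _ => mul_nonneg (mul_nonneg (apply_nonneg _ _) (apply_nonneg _ _)) (apply_nonneg _ _))
        (Finset.mem_univ w')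
    have hg0 : 0 ≤ w' (algebraMap (Fp L) L (g 1 1)) := apply_nonneg _ _
    calc w' (algebraMap (Fp L) L (g 1 1)) * w' (algebraMap (Fp L) L (Algebra.trace (Fp L) L (σ * imagUnit L)))
        ≤ w' (algebraMap (Fp L) L (g 1 1)) * (2 * (w' (algebraMap (Fp L) L (g k k / g 1 1)) * w' x * w' (imagUnit L))) :=
          mul_le_mul_of_nonneg_left htr hg0
      _ = (2 * (w' (algebraMap (Fp L) L (g 1 1)) * w' (algebraMap (Fp L) L (g k k / g 1 1)) * w' (imagUnit L))) * w' x := by ring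
      _ ≤ (2 * ∑ w'' : NumberField.InfinitePlace L, ∑ k' : Fin 2,
            w'' (algebraMap (Fp L) L (g 1 1)) * w'' (algebraMap (Fp L) L (g k' k' / g 1 1)) * w'' (imagUnit L)) * B :=
          mul_le_mul (mul_le_mul_of_nonneg_left hterm zero_le_two) (hB w') (apply_nonneg _ _) (mul_nonneg zero_le_two
            (Finset.sum_nonneg fun w'' _ => Finset.sum_nonneg fun k' _ =>
              mul_nonneg (mul_nonneg (apply_nonneg _ _) (apply_nonneg _ _)) (apply_nonneg _ _)))
      _ = Cτ * B := by rw [hCτ]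

end TauLetters

end Summit.HodgeConjecture.HodgeConjecture.Cruxes.HLiu418.K2LiuCornerScalarPoleCount

end
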